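import Summits.QuantumFields.YangMills.Theorems.BalabanUVNodesN15KingModelFreeRGDatum
import Summits.QuantumFields.YangMills.Theorems.BalabanUVNodesN15KingModelFreeRGChernoff
import Summits.QuantumFields.YangMills.Theorems.BalabanUVNodesN15KingModelFreeRGGreenLattice
import HarnessLib

/-!
# BalabanUVNodes ∕ N15 — THE KING-MODEL RUNG, FREE-FIELD EDITION (PART Τ-g₁, LETTERS FOR THEOREM 3.1): `e^{−S^{(k),1}} = ρ_{Δ^{(k)}}` is a Gaussian
# PROBABILITY density on `ℝ^{T₁^{(k)}}` (mass `1 = Z^{ε_K}`), the small-field integral is `≤ 1` ((3.3) with `C = 0`), its complement is the Gaussian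
# large-field mass `≤ 2|T₁^{(k)}|e^{−R_m²∕(2G)}` (part Τ-b), and the variance letter `G` for the datum's operators (part Τ-c₂) — uniformly in `k`
# (Track A, DAG node N15 = NE2; FAN-OUT v1.1 §N15 s3 «KING-MODEL RUNG»; regen R453 (b))

HONEST FRAMING.  Count-neutral (cell `pub-ymgap`, seat `pub-ymgap-dag-n15-e` g19; `--supports stmt-QuantumFields-27366 --as helper` = K3⁸
`SpineGivenEndpointR13SepCoPHV`).  TEMPLATE LITERATURE, `A = 0`: the letters of [King1986] Theorem 3.1 (3.3)–(3.4) p. 655 for the free-field datum of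
part Τ-e.  For the free field King's normalisation (2.6) makes `e^{−S^{(k),1}}` the centred Gaussian density `ρ_{Δ^{(k)}} = e^{−½⟨φ,Δ^{(k)}φ⟩}∕𝒩(Δ^{(k)})`
(`exp_neg_kingFreeS`), so `∫e^{−S^{(k),1}}dφ_k = 1 = Z^{ε_K}` (`integral_exp_neg_kingFreeS` — the mass-one bookkeeping King's (3.89)–(3.90) encodes),
the small-field integral `∫χ_k e^{−S^{(k),1}}` is `≤ 1` (the lower bound (3.3), with the correction constant `C = 0`), and `1 − ∫χ_k e^{−S^{(k),1}} =
∫(1 − χ_k)ρ ≤ 2|T₁^{(k)}|e^{−R_m²∕(2G)}` by part Τ-b's Chernoff-union bound for any `G` dominating the variances `⟨e_y, (Δ^{(k)})⁻¹e_y⟩`; §3 supplies that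
`G` for BOTH members of the datum's operator (`k = 0`: bare `−Δ¹ + m²ε_m²`, part Τ-c₂ `lapF_green_le`; `k ≥ 1`: King's `Δ^{(k)}`, `kingEffLap_green_le`)
with ONE `k`-uniform expression `greenLetter`.  Part Τ-g turns `2|T₁|e^{−R²∕(2G)} ≤ e^{−p(ε_m)²}` for `m ≥ J` into `Thm31Printed`.  Also: `χ ∈ {0,1}`,
measurability, and the schema's finiteness hypothesis `hfin` (every `∫χ e^{−S + c}` is finite).  HONEST SCOPE: datum of part Τ-e (cubic torus `M₀^d`,
`h = g = 0`, φ-clause of (3.2) at `λ := 1`, closed Gaussian form of `S^{(k),1}`); `1 ≤ d ≤ 3` where the variance letter is evaluated; `L ≥ 2`, `a, m² > 0`.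
NOT Bałaban's objects; NOT the interacting model's Theorem 3.1 ([Ba 1–2]'s cluster expansion); NOT a node discharge; nothing continuum-YM ∕ ℝ⁴ ∕ OS ∕
mass-gap ∕ Clay.  0 `sorry`; ONE reducible abbreviation (`greenLetter`); standard axioms.
Locators: [King1986] (2.6) p.652, (3.2) p.655, Thm 3.1 (3.3)–(3.4) p.655, (3.14) p.657, (3.89)–(3.90) pp.668–669, (4.35) p.674.
-/

noncomputable section

namespace Summit.QuantumFields.YangMills.BalabanUVNodes.N15KingModelRung.FreeField

open Real Finset Matrix MeasureTheory
open Literature.MathematicalPhysics.QuantumFieldTheory.Balaban1983to89 (B2.pFn)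
open Literature.MathematicalPhysics.QuantumFieldTheory.Balaban1983to89.B5Prop11Plancherel (Tor)
open Literature.MathematicalPhysics.QuantumFieldTheory.Balaban1983to89.QGQInverse (Coercive)
open Literature.LinearAlgebra.Matrix (dotProduct_self_nonneg_real)
open Literature.MathematicalPhysics.QuantumFieldTheory.King1986 (aK aK_pos aK_ge cDelta cDelta_pos)
open Literature.MathematicalPhysics.QuantumFieldTheory.King1986.Torus (lapF)
open Literature.MathematicalPhysics.QuantumFieldTheory.King1986.ContinuumLimit (eps eps_pos eps_le_one RGData)

variable {d : ℕ}

section Letters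

variable (L : ℕ) [NeZero L] (M₀ : ℕ) [NeZero M₀]

/-! ## §1 The datum's operator is symmetric and coercive, for every `k` -/

/-- **Coercivity of the datum's operator**, `k = 0` (bare) and `k ≥ 1` (King's `Δ^{(k)}`) alike, with the common floor `δ(a,L,m²ε_m²)`.
[cite: King1986, (2.14) p.653, (4.5) p.670] -/
theorem kingFreeOp_coercive {a msq : ℝ} (ha : 0 < a) (hL : 2 ≤ L) (hmsq : 0 < msq) (m k : ℕ) :
    Coercive (kingFreeOp (d := d) L M₀ a msq m k) (deltaFloor a L (unitMassSq msq L m)) := by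
  have hm2 : 0 < unitMassSq msq L m := by unfold unitMassSq; exact mul_pos hmsq (pow_pos (eps_pos (by omega) m) 2)
  rcases Nat.eq_zero_or_pos k with hk | hk
  · subst hk; rw [kingFreeOp_zero]; exact lapF_coercive_floor _ ha hL zero_le_one hm2
  · rw [kingFreeOp_of_pos L M₀ a msq m hk]; exact kingEffLap_coercive L _ ha hL hk hm2

/-- **Symmetry of the datum's operator**. [folklore] -/
theorem kingFreeOp_transpose (a msq : ℝ) (m k : ℕ) : (kingFreeOp (d := d) L M₀ a msq m k)ᵀ = kingFreeOp (d := d) L M₀ a msq m k := by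
  rcases Nat.eq_zero_or_pos k with hk | hk
  · subst hk; rw [kingFreeOp_zero]; exact lapF_transpose _ 1 _
  · rw [kingFreeOp_of_pos L M₀ a msq m hk]; exact kingEffLap_transpose L _ a _ k

/-! ## §2 `e^{−S^{(k),1}}` is the Gaussian probability density: mass one, (3.3), the large-field mass -/

/-- **`e^{−S^{(k),1}(φ)} = e^{−½⟨φ,Δ^{(k)}φ⟩}∕𝒩(Δ^{(k)})`** (King's normalisation (2.6)∕(3.89)–(3.90) at zero coupling). [cite: King1986, (2.6) p.652, (3.90) p.669] -/
theorem exp_neg_kingFreeS {a msq : ℝ} (ha : 0 < a) (hL : 2 ≤ L) (hmsq : 0 < msq) (m k : ℕ) (φ : Tor (cubeSide (d := d) M₀ L m) → ℝ) :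
    Real.exp (-kingFreeS L M₀ a msq m k φ)
      = Real.exp (-(1 / 2 : ℝ) * (φ ⬝ᵥ (kingFreeOp L M₀ a msq m k *ᵥ φ))) / gaussNorm (kingFreeOp (d := d) L M₀ a msq m k) := by
  obtain ⟨hδ, _⟩ := deltaFloor_pos_le L ha hL (show 0 < unitMassSq msq L m from by
    unfold unitMassSq; exact mul_pos hmsq (pow_pos (eps_pos (by omega) m) 2))
  have hN := gaussNorm_pos hδ (kingFreeOp_coercive (d := d) L M₀ ha hL hmsq m k)
  unfold kingFreeS
  rw [neg_add, Real.exp_add, Real.exp_neg (Real.log _), Real.exp_log hN, div_eq_mul_inv]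
  congr 1; ring_nf

/-- **`∫ e^{−S^{(k),1}} dφ_k = 1 = Z^{ε_K}`** — the free field's effective densities have mass one at every step. [cite: King1986, (2.6) p.652, (3.89)–(3.90) pp.668–669] -/
theorem integral_exp_neg_kingFreeS {a msq : ℝ} (ha : 0 < a) (hL : 2 ≤ L) (hmsq : 0 < msq) (m k : ℕ) :
    ∫ φ : Tor (cubeSide (d := d) M₀ L m) → ℝ, Real.exp (-kingFreeS L M₀ a msq m k φ) = 1 := by
  obtain ⟨hδ, _⟩ := deltaFloor_pos_le L ha hL (show 0 < unitMassSq msq L m from by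
    unfold unitMassSq; exact mul_pos hmsq (pow_pos (eps_pos (by omega) m) 2))
  simp_rw [exp_neg_kingFreeS L M₀ ha hL hmsq m k]
  exact integral_gaussDensity hδ (kingFreeOp_coercive (d := d) L M₀ ha hL hmsq m k)

open Classical in
/-- `χ` is measurable (the small-field box). [folklore] -/
theorem measurable_kingFreeChi (b₀ p : ℝ) (m : ℕ) : Measurable fun φ : Tor (cubeSide (d := d) M₀ L m) → ℝ => kingFreeChi L M₀ b₀ p m φ := by
  unfold kingFreeChi
  exact measurable_box (kingFreeThreshold d b₀ p L m)

/-- **The schema's finiteness hypothesis `hfin`**: every `∫χ_k e^{−S^{(k),1} + c} dφ_k` is finite (a bounded measurable function times the integrable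
Gaussian density). [cite: King1986, Thm 3.1 (3.3) p.655] -/
theorem integrable_chi_exp {a msq : ℝ} (ha : 0 < a) (hL : 2 ≤ L) (hmsq : 0 < msq) (b₀ p : ℝ) (m k : ℕ) (c : ℝ) :
    Integrable (fun φ : Tor (cubeSide (d := d) M₀ L m) → ℝ => kingFreeChi L M₀ b₀ p m φ * Real.exp (-kingFreeS L M₀ a msq m k φ + c)) := by
  obtain ⟨hδ, _⟩ := deltaFloor_pos_le L ha hL (show 0 < unitMassSq msq L m from by
    unfold unitMassSq; exact mul_pos hmsq (pow_pos (eps_pos (by omega) m) 2))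
  have hρ := integrable_gaussDensity hδ (kingFreeOp_coercive (d := d) L M₀ ha hL hmsq m k)
  have h2 : Integrable (fun φ : Tor (cubeSide (d := d) M₀ L m) → ℝ => Real.exp c
      * (Real.exp (-(1 / 2 : ℝ) * (φ ⬝ᵥ (kingFreeOp L M₀ a msq m k *ᵥ φ))) / gaussNorm (kingFreeOp (d := d) L M₀ a msq m k))) := hρ.const_mul _
  have h3 := h2.bdd_mul (c := 1) (measurable_kingFreeChi (d := d) L M₀ b₀ p m).aestronglyMeasurable
    (Filter.Eventually.of_forall fun φ => by
      obtain ⟨hc0, hc1⟩ := kingFreeChi_nonneg_le_one L M₀ b₀ p m φ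
      rw [Real.norm_eq_abs, abs_of_nonneg hc0]; exact hc1)
  refine h3.congr (Filter.Eventually.of_forall fun φ => ?_)
  simp only
  rw [Real.exp_add, exp_neg_kingFreeS L M₀ ha hL hmsq m k φ]
  ring

/-- **(3.3) FOR THE FREE FIELD (with `C = 0`)**: `∫χ_k e^{−S^{(k),1}} dφ_k ≤ 1 = Z^{ε_K}`. [cite: King1986, Thm 3.1 (3.3) p.655] -/
theorem smallField_le_one {a msq : ℝ} (ha : 0 < a) (hL : 2 ≤ L) (hmsq : 0 < msq) (b₀ p : ℝ) (m k : ℕ) :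
    ∫ φ : Tor (cubeSide (d := d) M₀ L m) → ℝ, kingFreeChi L M₀ b₀ p m φ * Real.exp (-kingFreeS L M₀ a msq m k φ) ≤ 1 := by
  have h1 := integrable_chi_exp (d := d) L M₀ ha hL hmsq b₀ p m k 0
  simp only [add_zero] at h1
  obtain ⟨hδ, _⟩ := deltaFloor_pos_le L ha hL (show 0 < unitMassSq msq L m from by
    unfold unitMassSq; exact mul_pos hmsq (pow_pos (eps_pos (by omega) m) 2))
  have hρ : Integrable (fun φ : Tor (cubeSide (d := d) M₀ L m) → ℝ => Real.exp (-kingFreeS L M₀ a msq m k φ)) := by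
    simp_rw [exp_neg_kingFreeS L M₀ ha hL hmsq m k]
    exact integrable_gaussDensity hδ (kingFreeOp_coercive (d := d) L M₀ ha hL hmsq m k)
  rw [← integral_exp_neg_kingFreeS (d := d) L M₀ ha hL hmsq m k]
  refine integral_mono h1 hρ fun φ => ?_
  obtain ⟨_, hc1⟩ := kingFreeChi_nonneg_le_one L M₀ b₀ p m φ
  have hpos : 0 ≤ Real.exp (-kingFreeS L M₀ a msq m k φ) := (Real.exp_pos _).le
  calc kingFreeChi L M₀ b₀ p m φ * Real.exp (-kingFreeS L M₀ a msq m k φ) ≤ 1 * Real.exp (-kingFreeS L M₀ a msq m k φ) :=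
        mul_le_mul_of_nonneg_right hc1 hpos
    _ = _ := one_mul _

/-- The threshold is non-negative. [folklore] -/
theorem kingFreeThreshold_nonneg {L : ℕ} (hL : 2 ≤ L) {b₀ p : ℝ} (hb : 0 ≤ b₀) (m : ℕ) : 0 ≤ kingFreeThreshold d b₀ p L m := by
  have hε1pos : 0 < eps L (m + 1) := eps_pos (by omega) (m + 1)
  have hε1le : eps L (m + 1) ≤ 1 := eps_le_one (by omega) (m + 1)
  unfold kingFreeThreshold
  refine mul_nonneg ?_ (Real.rpow_nonneg hε1pos.le _)
  rw [Literature.MathematicalPhysics.QuantumFieldTheory.King1986.ContinuumLimit.pFn_eq]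
  have hinv : 1 ≤ (eps L (m + 1))⁻¹ := one_le_inv_iff₀.mpr ⟨hε1pos, hε1le⟩
  have := Real.log_nonneg hinv
  exact mul_nonneg hb (Real.rpow_nonneg (by linarith) _)

/-- ★ **THE LARGE-FIELD MASS OF THE FREE FIELD**: for every `m, k` and every `G > 0` dominating the variances `⟨e_y, (Δ^{(k)})⁻¹e_y⟩` on `T₁^{(k)}`:
`1 − ∫χ_k e^{−S^{(k),1}} dφ_k ≤ 2|T₁^{(k)}|·e^{−R_m²∕(2G)}` (part Τ-b `largeField_mass_le`; mass one). [cite: King1986, Thm 3.1 (3.4) p.655] -/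
theorem one_sub_smallField_le {a msq b₀ p : ℝ} (ha : 0 < a) (hL : 2 ≤ L) (hmsq : 0 < msq) (hb : 0 ≤ b₀) (m k : ℕ) {G : ℝ} (hG : 0 < G)
    (hGy : ∀ y : Tor (cubeSide (d := d) M₀ L m), Pi.single y (1 : ℝ) ⬝ᵥ ((kingFreeOp (d := d) L M₀ a msq m k)⁻¹ *ᵥ Pi.single y 1) ≤ G) :
    1 - ∫ φ : Tor (cubeSide (d := d) M₀ L m) → ℝ, kingFreeChi L M₀ b₀ p m φ * Real.exp (-kingFreeS L M₀ a msq m k φ)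
      ≤ 2 * Fintype.card (Tor (cubeSide (d := d) M₀ L m)) * Real.exp (-(kingFreeThreshold d b₀ p L m ^ 2 / (2 * G))) := by
  classical
  obtain ⟨hδ, _⟩ := deltaFloor_pos_le L ha hL (show 0 < unitMassSq msq L m from by
    unfold unitMassSq; exact mul_pos hmsq (pow_pos (eps_pos (by omega) m) 2))
  have hco := kingFreeOp_coercive (d := d) L M₀ ha hL hmsq m k
  have hLF := largeField_mass_le hδ hco (kingFreeOp_transpose L M₀ a msq m k) (kingFreeThreshold_nonneg (d := d) (p := p) hL hb m) hG hGy
  have h1 := integrable_chi_exp (d := d) L M₀ ha hL hmsq b₀ p m k 0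
  simp only [add_zero] at h1
  have hρ : Integrable (fun φ : Tor (cubeSide (d := d) M₀ L m) → ℝ => Real.exp (-kingFreeS L M₀ a msq m k φ)) := by
    simp_rw [exp_neg_kingFreeS L M₀ ha hL hmsq m k]; exact integrable_gaussDensity hδ hco
  -- 1 − ∫χρ = ∫(1 − χ)ρ
  have heq : ∫ φ : Tor (cubeSide (d := d) M₀ L m) → ℝ, (1 - kingFreeChi L M₀ b₀ p m φ) * Real.exp (-kingFreeS L M₀ a msq m k φ)
      = 1 - ∫ φ : Tor (cubeSide (d := d) M₀ L m) → ℝ, kingFreeChi L M₀ b₀ p m φ * Real.exp (-kingFreeS L M₀ a msq m k φ) := by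
    have e : (fun φ : Tor (cubeSide (d := d) M₀ L m) → ℝ => (1 - kingFreeChi L M₀ b₀ p m φ) * Real.exp (-kingFreeS L M₀ a msq m k φ))
        = fun φ => Real.exp (-kingFreeS L M₀ a msq m k φ) - kingFreeChi L M₀ b₀ p m φ * Real.exp (-kingFreeS L M₀ a msq m k φ) := by
      funext φ; ring
    rw [e, integral_sub hρ h1, integral_exp_neg_kingFreeS (d := d) L M₀ ha hL hmsq m k]
  rw [← heq]
  simp_rw [exp_neg_kingFreeS L M₀ ha hL hmsq m k]
  unfold kingFreeChi
  exact hLF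

/-! ## §3 The variance letter for the datum's operators, uniform in `k` -/

/-- **The variance letter** `G(a, L, m², d; M)` at unit-lattice mass `m2` on the cube of side `M`:
`M^{−d}·((a(1−L⁻²))⁻¹ + m2⁻¹ + (c(a,L)⁻¹ + π²∕4)(M∕2π)²·2d·2·3^{d−1}(√M)^{d−1})` — dominates part Τ-c₂'s bounds for the bare action AND for every
`Δ^{(k)}`, `k ≥ 1`. Reducible name. [cite: King1986, (4.35) p.674] -/
abbrev greenLetter (a : ℝ) (L : ℕ) (m2 : ℝ) (d : ℕ) (M : ℕ) : ℝ :=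
  ((M : ℝ) ^ d)⁻¹ * (((a * (1 - ((L : ℝ) ^ 2)⁻¹))⁻¹ + m2⁻¹)
    + ((cDelta (a * (1 - ((L : ℝ) ^ 2)⁻¹))⁻¹ d)⁻¹ + π ^ 2 / 4) * ((M : ℝ) / (2 * π)) ^ 2 * (2 * d * (2 * 3 ^ (d - 1) * Real.sqrt M ^ (d - 1))))

omit [NeZero L] in
/-- `G > 0`. [folklore] -/
theorem greenLetter_pos {a : ℝ} (ha : 0 < a) (hL : 2 ≤ L) {m2 : ℝ} (hm : 0 < m2) (hd1 : 1 ≤ d) (M : ℕ) [NeZero M] : 0 < greenLetter a L m2 d M := by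
  have hamin : 0 < a * (1 - ((L : ℝ) ^ 2)⁻¹) := mul_pos ha (one_sub_invSq_pos hL)
  have hc : 0 < cDelta (a * (1 - ((L : ℝ) ^ 2)⁻¹))⁻¹ d := cDelta_pos (inv_pos.mpr hamin).le d
  have hM : (0 : ℝ) < M := by exact_mod_cast Nat.pos_of_ne_zero (NeZero.ne M)
  have hd : (0 : ℝ) < d := by exact_mod_cast hd1
  unfold greenLetter
  positivity

/-- ★ **THE VARIANCES OF THE DATUM'S GAUSSIANS ARE DOMINATED BY THE LETTER**, for every `k` (`k = 0`: `lapF_green_le` with `c = 4∕π²`; `k ≥ 1`: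
`kingEffLap_green_le` with `c(a,L)`, `a_k⁻¹ ≤ (a(1−L⁻²))⁻¹`), `1 ≤ d ≤ 3`. [cite: King1986, (4.35) p.674] -/
theorem kingFreeOp_green_le (hd1 : 1 ≤ d) (hd3 : d ≤ 3) {a msq : ℝ} (ha : 0 < a) (hL : 2 ≤ L) (hmsq : 0 < msq) (m k : ℕ)
    (y : Tor (cubeSide (d := d) M₀ L m)) :
    Pi.single y (1 : ℝ) ⬝ᵥ ((kingFreeOp (d := d) L M₀ a msq m k)⁻¹ *ᵥ Pi.single y 1) ≤ greenLetter a L (unitMassSq msq L m) d (M₀ * L ^ m) := by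
  have hL1 : (1 : ℝ) < L := by exact_mod_cast hL
  have hm2 : 0 < unitMassSq msq L m := by unfold unitMassSq; exact mul_pos hmsq (pow_pos (eps_pos (by omega) m) 2)
  have hamin : 0 < a * (1 - ((L : ℝ) ^ 2)⁻¹) := mul_pos ha (one_sub_invSq_pos hL)
  have hc : 0 < cDelta (a * (1 - ((L : ℝ) ^ 2)⁻¹))⁻¹ d := cDelta_pos (inv_pos.mpr hamin).le d
  have hMs : (0 : ℝ) < ((M₀ * L ^ m : ℕ) : ℝ) := by exact_mod_cast Nat.pos_of_ne_zero (NeZero.ne (M₀ * L ^ m))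
  have hW : 0 ≤ (((M₀ * L ^ m : ℕ) : ℝ) / (2 * π)) ^ 2 * (2 * d * (2 * 3 ^ (d - 1) * Real.sqrt ((M₀ * L ^ m : ℕ) : ℝ) ^ (d - 1))) := by positivity
  have hπ : (0 : ℝ) ≤ π ^ 2 / 4 := by positivity
  rcases Nat.eq_zero_or_pos k with hk | hk
  · subst hk
    rw [kingFreeOp_zero]
    refine (lapF_green_le (M₀ * L ^ m) hd1 hd3 hm2 y).trans ?_
    unfold greenLetter
    refine mul_le_mul_of_nonneg_left ?_ (by positivity)
    have e4 : ((4 : ℝ) / π ^ 2)⁻¹ = π ^ 2 / 4 := by rw [inv_div]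
    rw [e4]
    have h1 : (unitMassSq msq L m)⁻¹ ≤ (a * (1 - ((L : ℝ) ^ 2)⁻¹))⁻¹ + (unitMassSq msq L m)⁻¹ := le_add_of_nonneg_left (inv_pos.mpr hamin).le
    have h2 : π ^ 2 / 4 * (((M₀ * L ^ m : ℕ) : ℝ) / (2 * π)) ^ 2 * (2 * d * (2 * 3 ^ (d - 1) * Real.sqrt ((M₀ * L ^ m : ℕ) : ℝ) ^ (d - 1)))
        ≤ ((cDelta (a * (1 - ((L : ℝ) ^ 2)⁻¹))⁻¹ d)⁻¹ + π ^ 2 / 4) * (((M₀ * L ^ m : ℕ) : ℝ) / (2 * π)) ^ 2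
          * (2 * d * (2 * 3 ^ (d - 1) * Real.sqrt ((M₀ * L ^ m : ℕ) : ℝ) ^ (d - 1))) := by
      rw [mul_assoc, mul_assoc (_ + _)]
      exact mul_le_mul_of_nonneg_right (le_add_of_nonneg_left (inv_pos.mpr hc).le) hW
    linarith
  · rw [kingFreeOp_of_pos L M₀ a msq m hk]
    refine (kingEffLap_green_le (M₀ * L ^ m) hd1 hd3 ha hL hk hm2 y).trans ?_
    unfold greenLetter
    refine mul_le_mul_of_nonneg_left ?_ (by positivity)
    have hak : 0 < aK a L k := aK_pos ha hL1 hk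
    have h1 : (aK a L k)⁻¹ + (unitMassSq msq L m)⁻¹ ≤ (a * (1 - ((L : ℝ) ^ 2)⁻¹))⁻¹ + (unitMassSq msq L m)⁻¹ := by
      have := inv_anti₀ hamin (aK_ge ha hL1 hk); linarith
    have h2 : (cDelta (a * (1 - ((L : ℝ) ^ 2)⁻¹))⁻¹ d)⁻¹ * (((M₀ * L ^ m : ℕ) : ℝ) / (2 * π)) ^ 2
          * (2 * d * (2 * 3 ^ (d - 1) * Real.sqrt ((M₀ * L ^ m : ℕ) : ℝ) ^ (d - 1)))
        ≤ ((cDelta (a * (1 - ((L : ℝ) ^ 2)⁻¹))⁻¹ d)⁻¹ + π ^ 2 / 4) * (((M₀ * L ^ m : ℕ) : ℝ) / (2 * π)) ^ 2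
          * (2 * d * (2 * 3 ^ (d - 1) * Real.sqrt ((M₀ * L ^ m : ℕ) : ℝ) ^ (d - 1))) := by
      rw [mul_assoc, mul_assoc (_ + _)]
      exact mul_le_mul_of_nonneg_right (le_add_of_nonneg_right hπ) hW
    linarith

/-- ★★ **THE LARGE-FIELD MASS WITH THE LETTER**: for `1 ≤ d ≤ 3` and every `m, k`,
`1 − ∫χ_k e^{−S^{(k),1}} dφ_k ≤ 2|T₁^{(k)}|·exp(−R_m²∕(2G_m))`, `G_m = greenLetter a L (m²ε_m²) d (M₀L^m)`. [cite: King1986, Thm 3.1 (3.4) p.655] -/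
theorem one_sub_smallField_le_letter (hd1 : 1 ≤ d) (hd3 : d ≤ 3) {a msq b₀ p : ℝ} (ha : 0 < a) (hL : 2 ≤ L) (hmsq : 0 < msq) (hb : 0 ≤ b₀) (m k : ℕ) :
    1 - ∫ φ : Tor (cubeSide (d := d) M₀ L m) → ℝ, kingFreeChi L M₀ b₀ p m φ * Real.exp (-kingFreeS L M₀ a msq m k φ)
      ≤ 2 * Fintype.card (Tor (cubeSide (d := d) M₀ L m))
        * Real.exp (-(kingFreeThreshold d b₀ p L m ^ 2 / (2 * greenLetter a L (unitMassSq msq L m) d (M₀ * L ^ m)))) := by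
  have hm2 : 0 < unitMassSq msq L m := by unfold unitMassSq; exact mul_pos hmsq (pow_pos (eps_pos (by omega) m) 2)
  exact one_sub_smallField_le L M₀ ha hL hmsq hb m k (greenLetter_pos L ha hL hm2 hd1 (M₀ * L ^ m))
    (fun y => kingFreeOp_green_le L M₀ hd1 hd3 ha hL hmsq m k y)

end Letters

end Summit.QuantumFields.YangMills.BalabanUVNodes.N15KingModelRung.FreeField

end
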